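import Summits.QuantumFields.YangMills.Theorems.UnitScaleTiltHalvingP1FlatCoreTopStepTorus
import Summits.QuantumFields.YangMills.Theorems.UnitScaleTiltHalvingP1FlatCoreSupplierLowerFamily
import Literature.MathematicalPhysics.QuantumFieldTheory.Balaban1983to89.B8SockHFPRD
import HarnessLib

/-!
# `hP1room` PROGRAMME (LEAD-H «H = hSupU» BOARD v2 (S3), RULING L-10), (A-1) STAGE 3b FILE B: ★★★ THE TOP-STEP CALL — ✓`P1FlatCoreTopStepTorus.hFP_kLevel_top_RD`
# (✓p636261) AT THEOREM 4's INDUCTIVE DATUM OF pub-ymgap N05: the (o)-top twin of ✓`B8SockHFPRD.sockHFP_body_of_join_RD`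

Route `UnitScaleTilt`, crux K1 child «MinimiserStabilityRegPr» (stmt-QuantumFields-19200), registered stub `stub_halvingStep` (`BirthV10`), text `hP1room ⟸ hSupU`
(✓p641613 ∘ ✓p640588; per site ✓p643656 `HalvingP1FlatCoreSupplierDoor.hSup_of_contentRows` over nine content rows).  Cell `ym3-torus` (HUMAN RULING D-0037: YM₃ on T³ is ladder rung
R3 — NOT d = 4, NOT a mass gap, NOT the Clay problem), width seat `ym-ust-20520-w3` gen 6.  `--supports stmt-QuantumFields-19200 --as helper`; THEOREMS ONLY (0 `def`, 0 `sorry`);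
count-neutral; nothing here claims `core′`, `hP1room`, `hSupU`, the stub, the crux or the gap.

WHAT.  ★★★ `topRows_of_datum` — EXACTLY ✓`B8SockHFPRD.sockHFP_body_of_join_RD` (Prop. 5 at `m + 1` levels from Theorem 4's inductive datum at level `m`: the member's nested regions
`Ω`, truncated structures `Λs m′`, bond classes `Λb`; (1.33)∕(1.34)∕`Ax`∕(1.35) of the pre-gauged field `U′`; the datum `u₁, U₁ = U′^{u₁⁻¹}, A` with (1.29) at `m` levels, the Landau
condition of record and the chart∕sizes on the sides touching `Ω_j`; the b9 socket at level `m`; the [4] letters at `(m+1, U₀)` with their laws and bounds; the JOIN's windows) READ AT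
THE FLAT BACKGROUND `U₀ = 1`, with the JOIN ✓`hFP_kLevel_of_sectE_local'_RD` REPLACED by the H-line's top step ✓`hFP_kLevel_top_RD`: the lower family rows (C) come from FILE A
✓`HalvingP1FlatCoreSupplierLowerFamily.lowerFamily_rows` at `(Λs (m+1), U₀ := 1)`, the datum rows `hA hDA hDAsa hEbΩ hEbT` from ✓`B8Prop5SocketDatum` exactly as N05 reads them, and
the torus blocks (D) (`W₁ κf rep hrep y₀ th hτ hth hthk hthlo haxT`) and (E) (`hTop121 hTop125 hTopReal`) with the top-step windows (`hCbρ hClB ha₁' hb₁' hθ hh₀' h103 h106`, at one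
`Cb ≥ C2p(40d·c_B + α₄)α₄`, `Cl ≥ 2C2p(40d·c_B + 2α₄)`) are DISPLAYED VERBATIM in ✓p636261's letters (suppliers: ✓p642293 `…TopTargetRep`, F3 ✓p633797, ✓p638927∕✓p643367 `…TopRowsLocal∕Real`).
OUTPUT: `∃ λ′`, Hermitian, `= 0` off `Ω₀`, (1.108) on the sides touching `Ω_j` (`j ≤ m+1`), the multiplier form of the Landau equation on `Ω₀` FOR THE DATUM's `A` (transported back from
the masked exponent as in N05), (lo) `Q′_j(u₁⁻¹, e^{−iλ′}) = 0` below the top, (top) `κf[(−iλ′) ∘ rep]_{m+1} = axialT (U̿^{(m+1)}W₁)(y₀, ·)` on `Λs (m+1) (m+1)` — AND the level-`0`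
size row of `A` on `Ω₀` (for ✓`HalvingP1FlatCoreSupplierLandau.isLandau138W_of_topStepOutput`, whose `h108`∕`hEbΩ` inputs are the third conjunct and ✓`sideTouches_pair_of_mem`).
HONEST SCOPE.  By-name plumbing; every analytic row stays DISPLAYED (N05's letters∕b9 sockets, the pre-gauge rows, the torus blocks); nothing of Prop. 5, Theorem 4, `core′` or the
stub is proved here; the per-site knit to ✓p643656's nine rows is the next file.

References: T. Bałaban, CMP **99** (1985) 75–102 [Balaban1985RegularSpaces] (Prop. 5 (1.106)–(1.109) p.94, Thm 4 p.88, (1.67)–(1.69) p.88, (1.92)–(1.103) pp.92–93,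
Sect. E (1.112)–(1.125) pp.95–97, (1.79) p.90); CMP **99** (1985) 389–434 [Balaban1985BackgroundPropagators] (Thm 3.1 p.397, (3.25) p.394, Thm 3.3 p.398);
CMP **98** (1985) 17–51 [Balaban1985Averaging] ((97)–(100) p.32, (208)–(214) p.50).
-/

set_option autoImplicit false

noncomputable section

open scoped BigOperators
open NormedSpace
open Complex (I)

namespace Summit.QuantumFields.YangMills.Theorems.HalvingP1FlatCoreSupplierTopCall

open Literature.MathematicalPhysics.QuantumFieldTheory.Balaban1983to89
open T4Continuum
open MatrixLog (mlog)
open B7Prop1Explicit (e expUnit U1)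
open B7Prop2Explicit (unitaryUnits unitaryUnits_le_U1 C0 c2' avgIter)
open B7Prop3Flat (c3)
open B7Prop10General (C6 C4G)
open B7Prop9Flat (C5')
open B7Prop1Local (InBox pdevOn loK bondHiK)
open B7Eq78Linearization (conjR zdBlocking QprimeIter)
open B7Eq170Flat (cj)
open B7Eq92Concrete (mgauge)
open B8Ineq130 (tlo thi)
open B8Ineq132 (covDerivFwd covDeriv InAk)
open B8Eq119TwistedAxial (Restr129 InAx bgT)
open B8Eq184Proof (gaugeExp cfgExp)
open B8Eq182Proof (gAd)
open B8Eq188Proof (frakF3)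
open B8Lemma1NonAbelian (mulCfg)
open B8Eq140Level (SideTouches)
open B8Eq146AExpansion (iEta)
open B8Thm2LogB (blockTop)
open B8Eq138LandauZd (IsLandau138W covDivB covLap QT)
open B8Ineq125Concrete (C2p C2p_nonneg)
open B8Eq1117Concrete (XSpace)
open B8Eq155JBound (expCfg_iEta_mem_unitaryUnits)
open B8LeafModelZd3 (SockB9P3)
open B8Prop5ContractionKLevel (Bd2 Mc Kc)
open B8LambdaSpaceKLevel (wt)
open B8Eq178Averages (Qnl)
open B8Eq1123Concrete (Cnl)
open B8Prop5SocketDatum (exists_masked_datum grad_bound_of_datum bd2_covDivB_of_grad restr129_succ_of_truncation sideTouches_pair_of_mem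
  sideTouches_of_tower_bond h33_of_inAk hP_of_datum h69_of_datum hA_of_datum)
open B8SockHFPAssembly (isSelfAdjoint_covDivB covDivB_congr_at frakF3_congr_at inAx_mgauge_expCfg_of_datum)
open Literature.MathematicalPhysics.QuantumLattice (blockSites)
open B10Eq27TorusAxialLog (axialT)
open Node00 (coverAt)
open B15Eq112TorusCover (cover)
open LatticeFieldCalculus (siteAvgIter)
open Summit.QuantumFields.YangMills.Theorems.Prop8ChartDoubleBar (dbarIterU)
open Summit.QuantumFields.YangMills.Theorems.P1FlatCoreTopStepTorus (hFP_kLevel_top_RD)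
open Summit.QuantumFields.YangMills.Theorems.HalvingP1FlatCoreSupplierLowerFamily (lowerFamily_rows)

-- `Site` alone could resolve to the torus sites; N05's carriers are `Fin d → ℤ`.
open B7Prop1Explicit (Site)

variable {P : Params} {𝔸 : Type*} [CStarAlgebra 𝔸] [Nontrivial 𝔸]

/-- ★★★ **THE TOP-STEP CALL AT THEOREM 4's INDUCTIVE DATUM** (the (o)-top twin of ✓`B8SockHFPRD.sockHFP_body_of_join_RD`, flat background).  See the module docstring for the
binder blocks; every N05 binder is that theorem's VERBATIM at `U₀ := 1`, `d := P.d`, `L := P.L`; the torus blocks (D)(E) and the top-step windows are ✓p636261's VERBATIM at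
`k := m + 1`, `Λs := Λs (m+1)`, `Eb j := {b | SideTouches (Ω j) b}`.
[cite: Balaban1985RegularSpaces, Prop. 5 (1.106)-(1.109) p.94, Thm 4 p.88, (1.67)-(1.69) p.88, (1.92)-(1.103) pp.92-93, (1.112)-(1.125) pp.95-97; Balaban1985BackgroundPropagators, Thm 3.1 p.397, (3.25) p.394, Thm 3.3 p.398; Balaban1985Averaging, (208)-(214) p.50] -/
theorem topRows_of_datum (hd2 : 2 ≤ P.d) (hL : 2 ≤ P.L) {η : ℝ} (hη : 0 < η) {K₀ : ℕ}
    -- the member's geometry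
    {Ω : ℕ → Set (Site P.d)} (hΩ : ∀ j, Ω (j + 1) ⊆ Ω j) {Λs : ℕ → ℕ → Set (Site P.d)} {Λb : ℕ → ℕ → Set (Site P.d × Fin P.d)}
    (hbox : ∀ m, m ≤ K₀ → ∀ j, j ≤ m → ∀ c ∈ Λb m j, ∀ x, InBox (loK P.L j c.1) (bondHiK P.L j c.1 c.2) x → x ∈ Ω j)
    (hclass : ∀ m, m ≤ K₀ → ∀ j, j ≤ m → ∀ c ∈ Λb m j,
      (c.1 ∈ Λs m j ∧ c.1 + e c.2 ∈ Λs m j) ∨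
      (∃ j', j = j' + 1 ∧ (∀ x, (P.L : ℤ) • c.1 ≤ x → x ≤ (P.L : ℤ) • c.1 + blockTop P.L → x ∈ Λs m j') ∧ c.1 + e c.2 ∈ Λs m j) ∨
      (∃ j', j = j' + 1 ∧ c.1 ∈ Λs m j ∧ (∀ x, (P.L : ℤ) • (c.1 + e c.2) ≤ x → x ≤ (P.L : ℤ) • (c.1 + e c.2) + blockTop P.L → x ∈ Λs m j')))
    {m : ℕ} (hm1 : 1 ≤ m) (hmk : m < K₀) (hmP : m + 1 ≤ P.m + P.K)
    (htower : ∀ j, j ≤ m + 1 → ∀ y ∈ Λs (m + 1) j, ∀ x, InBox (tlo P.L y j) (thi P.L y j) x → x ∈ Ω j)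
    (hlt : ∀ j, j < m → Λs m j = Λs (m + 1) j)
    (htop : ∀ x, x ∈ Λs m m ↔ x ∈ Λs (m + 1) m ∨ ∃ y ∈ Λs (m + 1) (m + 1), x ∈ blockSites P.L y)
    -- the socket's antecedents: constants, (1.33), (1.34), (1.35)/(1.66) for the pre-gauged field `U′` at the flat background
    {α₀ α₁ B₀ B₀' cs α₄ : ℝ} (hα₀ : 0 < α₀) (hα₁ : 0 < α₁) (hB₀ : 0 < B₀) (hB₀' : 0 < B₀')
    (hcs : cs = 5 * (P.d : ℝ) * P.L * B₀ * (α₀ + α₁)) (hα₄ : α₄ = 8 * B₀' * (5 * (P.d : ℝ) * P.L * B₀) * (α₀ + α₁))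
    {U' : Site P.d → Fin P.d → 𝔸ˣ} (hU' : ∀ x κ, U' x κ ∈ unitaryUnits 𝔸)
    (h33 : InAk P.L K₀ η α₀ Ω (1 : Site P.d → Fin P.d → 𝔸ˣ)) (h34 : InAk P.L K₀ η α₀ Ω (mulCfg U' 1))
    (hAx : ∀ m', m' ≤ K₀ → InAx P.L m' (Λs m') (1 : Site P.d → Fin P.d → 𝔸ˣ) (mulCfg U' 1))
    (h135 : ∀ j, j ≤ K₀ → ∀ (z : Site P.d) (μ : Fin P.d), (∀ x, InBox (loK P.L j z) (bondHiK P.L j z μ) x → x ∈ Ω j) →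
      ‖(avgIter P.L (mulCfg U' 1) j z μ : 𝔸) - (avgIter P.L (1 : Site P.d → Fin P.d → 𝔸ˣ) j z μ : 𝔸)‖ ≤ α₁)
    -- the datum at level `m`
    {u₁ : Site P.d → 𝔸ˣ} {U₁ : Site P.d → Fin P.d → 𝔸ˣ} {A : Site P.d → Fin P.d → 𝔸}
    (hu₁ : ∀ x, u₁ x ∈ unitaryUnits 𝔸) (hW : mgauge (1 : Site P.d → Fin P.d → 𝔸ˣ) u₁ U₁ = U') (h129 : Restr129 P.L m (Λs m) (1 : Site P.d → Fin P.d → 𝔸ˣ) u₁)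
    (hLan : IsLandau138W P.L m η (Ω 0) (Λs m) (1 : Site P.d → Fin P.d → 𝔸ˣ) U₁)
    (hdat : ∀ j, j ≤ m → ∀ b ∈ {b : Site P.d × Fin P.d | SideTouches (Ω j) b.1 b.2},
      U₁ b.1 b.2 = cfgExp η A b.1 b.2 ∧ IsSelfAdjoint (A b.1 b.2) ∧ ‖A b.1 b.2‖ ≤ cs * ((P.L : ℝ) ^ j * η)⁻¹)
    -- the b9 socket in Proposition 3's frame AT LEVEL `m`, and its threshold
    {B₀β cB9 β : ℝ} {len : Site P.d → ℝ} (SB9 : SockB9P3 (𝔸 := 𝔸) P.L B₀ B₀β cB9 β len η m Ω Λs Λb)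
    (hα₀9 : α₀ ≤ cB9) (hcs9 : cs ≤ cB9)
    -- Proposition 3's windows at `(α₀, α₂ := c⋆)` not implied by the JOIN's
    {C₂ : ℝ} (hside : 36 * P.d * B₀ * cs ≤ 1 / 2)
    (hC₂ : 8 * (131072 * ((P.d : ℝ) + 1) ^ 2) * Real.exp (4 * (800 * ((P.d : ℝ) + 1) ^ 2 * ((P.d : ℝ) + 4)) * α₀) ≤ C₂)
    (h61 : 2 * cs ^ 2 + 20 * P.d * α₀ * cs + 2 * C₂ * cs ^ 2 ≤ α₀ + α₁) (hsmall₁ : (P.d : ℝ) * P.L * α₁ ≤ 1 / 8)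
    -- the [4] LETTERS at `(m + 1, U₀ := 1)`, displayed as the top step reads them
    (g Δ : (Site P.d → 𝔸) →ₗ[ℂ] (Site P.d → 𝔸)) (q : (Site P.d → 𝔸) →ₗ[ℂ] (ℕ → Site P.d → 𝔸)) (qs : (ℕ → Site P.d → 𝔸) →ₗ[ℂ] (Site P.d → 𝔸))
    (Aw c : (ℕ → Site P.d → 𝔸) →ₗ[ℂ] (ℕ → Site P.d → 𝔸))
    (g_rightΩ : ∀ x, ∀ y ∈ Ω 0, (Δ (g x) + qs (Aw (q (g x)))) y = x y)
    (c_range : ∀ f, q (g (g (qs (c (q f))))) = q f)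
    (hΔ : ∀ (f : Site P.d → 𝔸), ∀ x ∈ Ω 0, Δ f x = covLap η (1 : Site P.d → Fin P.d → 𝔸ˣ) ((Ω 0).indicator f) x)
    (hqs : ∀ (μ : ℕ → Site P.d → 𝔸), ∀ x ∈ Ω 0, qs μ x = QT P.L (m + 1) (Λs (m + 1)) (1 : Site P.d → Fin P.d → 𝔸ˣ) μ x)
    (hq : ∀ (f : Site P.d → 𝔸) (j : ℕ), j ≤ m + 1 → ∀ y ∈ Λs (m + 1) j,
      q f j y = QprimeIter (zdBlocking P.d P.L) (bgT P.L (1 : Site P.d → Fin P.d → 𝔸ˣ)) j f y)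
    (H' : XSpace P.d (m + 1) 𝔸 →ₗ[ℂ] (Site P.d → 𝔸)) {B₀'H B₂' BG BR : ℝ} (hB₀'H : 0 < B₀'H) (hB₂' : 0 ≤ B₂') (hBG : 0 ≤ BG) (hBR : 0 ≤ BR)
    (hH0 : ∀ (X : XSpace P.d (m + 1) 𝔸) (x : Site P.d), ‖H' X x‖ ≤ B₀'H * ‖X‖)
    (hH1 : ∀ j, j ≤ m + 1 → ∀ (X : XSpace P.d (m + 1) 𝔸), ∀ p ∈ {b : Site P.d × Fin P.d | SideTouches (Ω j) b.1 b.2},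
      wt P.L η j * ‖covDerivFwd η (1 : Site P.d → Fin P.d → 𝔸ˣ) p.2 (H' X) p.1‖ ≤ B₀'H * ‖X‖)
    (hH2 : ∀ X : XSpace P.d (m + 1) 𝔸, Bd2 P.L η (m + 1) Ω (covLap η (1 : Site P.d → Fin P.d → 𝔸ˣ) (H' X)) (B₂' * ‖X‖))
    (hHsupp : ∀ (X : XSpace P.d (m + 1) 𝔸) (x : Site P.d), x ∉ Ω 0 → H' X x = 0)
    (hHequiv : ∀ X Y : XSpace P.d (m + 1) 𝔸, (∀ p, Y p = -star (X p)) → ∀ x, H' Y x = -star (H' X x))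
    (hQH : ∀ (Y : XSpace P.d (m + 1) 𝔸) (j : ℕ) (hj : j ≤ m + 1) (y : Site P.d), y ∈ Λs (m + 1) j →
      QprimeIter (zdBlocking P.d P.L) (bgT P.L (1 : Site P.d → Fin P.d → 𝔸ˣ)) j (H' Y) y = Y (⟨j, Nat.lt_succ_of_le hj⟩, y))
    (hG : ∀ (f : Site P.d → 𝔸) (r : ℝ), 0 ≤ r → Bd2 P.L η (m + 1) Ω f r →
      (∀ x, ‖g f x‖ ≤ BG * r) ∧ ∀ j, j ≤ m + 1 → ∀ p ∈ {b : Site P.d × Fin P.d | SideTouches (Ω j) b.1 b.2},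
        wt P.L η j * ‖covDerivFwd η (1 : Site P.d → Fin P.d → 𝔸ˣ) p.2 (g f) p.1‖ ≤ BG * r)
    (hGsupp : ∀ (f : Site P.d → 𝔸) (x : Site P.d), x ∉ Ω 0 → g f x = 0)
    (hGreal : ∀ f : Site P.d → 𝔸, (∀ j, j ≤ m + 1 → ∀ x ∈ Ω j, IsSelfAdjoint (f x)) → ∀ x, IsSelfAdjoint (g f x))
    (hRbd : ∀ (f : Site P.d → 𝔸) (r : ℝ), 0 ≤ r → Bd2 P.L η (m + 1) Ω f r → Bd2 P.L η (m + 1) Ω (f - g (qs (c (q (g f))))) (BR * r))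
    (hRreal : ∀ f : Site P.d → 𝔸, (∀ j, j ≤ m + 1 → ∀ x ∈ Ω j, IsSelfAdjoint (f x)) →
      ∀ j, j ≤ m + 1 → ∀ x ∈ Ω j, IsSelfAdjoint ((f - g (qs (c (q (g f))))) x))
    -- the JOIN's scalar windows (the lower family's, N05's letters; `cB cA cDA` free above their datum values)
    {cB cA cDA : ℝ} (hcBlo : P.L * cs ≤ cB) (hcAlo : P.L * cs ≤ cA) (hcDAlo : (P.d : ℝ) * (P.L : ℝ) ^ 2 * cs ≤ cDA)
    (hα3 : C0 P.d * α₀ ≤ 1 / 3) (hα4 : 4 * α₀ ≤ c2' P.d P.L)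
    (hsmall : Real.exp (4 * (800 * ((P.d : ℝ) + 1) ^ 2 * ((P.d : ℝ) + 4)) * α₀) * (1 + 8 * (131072 * ((P.d : ℝ) + 1) ^ 2) * cB) ≤ 2)
    (hc₃ : 2 * cB ≤ c3 P.d P.L) (hsc : 2048 * (P.d : ℝ) * cB ≤ 1) (hα₃' : 40 * P.d * cB ≤ 1 / 200)
    (hs₁ : 200 * C6 P.d * (2 * α₄) ≤ 1) (hs₂ : 12000 * ((P.d : ℝ) + 1) * P.L * (2 * α₄) ≤ 1)
    (hs₃ : C4G P.d P.L * (α₀ + 40 * P.d * cB + 4 * (2 * α₄)) ≤ 1)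
    (hs₄ : 1024 * ((P.d : ℝ) + 1) * ((P.d : ℝ) + 4) * P.L ^ 2 * α₀ ≤ 1) (hs₅ : 32 * ((P.d : ℝ) + 1) ^ 2 * C6 P.d * P.L ^ 2 * α₀ ≤ 1)
    (hs₆ : 16 * P.d * C5' P.d * C6 P.d * (P.L : ℝ) ^ 2 * α₀ ≤ 1) (hs₇ : 8 * P.d * C6 P.d * P.L * α₀ ≤ 1)
    (hprod8 : 2 * C6 P.d * (40 * P.d * cB + 4 * α₄) ≤ 1 / 8) (hcA' : cA ≤ 1 / 13)
    -- the family constants of the top step: above the lower family's; the top member's are the torus windows' business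
    {Cb Cl : ℝ} (hCblo : C2p P.d * (40 * P.d * cB + α₄) * α₄ ≤ Cb) (hCllo : 2 * C2p P.d * (40 * P.d * cB + 2 * α₄) ≤ Cl)
    (hCbρ : Cb ≤ α₄ / (2 * B₀'H)) (hClB : Cl * B₀'H ≤ 1 / 2)
    -- (D) the torus side: the effective-gauge tower of the charted iterate, the representative, the target (✓p636261's letters VERBATIM at `k := m + 1`)
    (W₁ : GaugeField P 0 𝔸ˣ) (κf : (Literature.MathematicalPhysics.QuantumFieldTheory.Balaban1983to89.Site P 0 → 𝔸) → (i : ℕ) → GaugeTransf P i 𝔸ˣ)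
    (rep : Literature.MathematicalPhysics.QuantumFieldTheory.Balaban1983to89.Site P 0 → Site P.d)
    (hrep : ∀ yc ∈ Λs (m + 1) (m + 1), ∀ x : Site P.d, InBox (tlo P.L yc (m + 1)) (thi P.L yc (m + 1)) x → rep (cover P x) = x)
    (y₀ : Literature.MathematicalPhysics.QuantumFieldTheory.Balaban1983to89.Site P (m + 1))
    (th : XSpace P.d (m + 1) 𝔸) (hτ : B₀'H * ‖th‖ < α₄ / 4) (hth : ∀ p, star (th p) = -th p)
    (hthk : ∀ yc ∈ Λs (m + 1) (m + 1), th (⟨m + 1, Nat.lt_succ_self (m + 1)⟩, yc) = mlog ((axialT (dbarIterU (m + 1) W₁) y₀ (coverAt P (m + 1) yc) : 𝔸ˣ) : 𝔸))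
    (hthlo : ∀ (j : ℕ) (hj : j < m + 1) (y : Site P.d), y ∈ Λs (m + 1) j → th (⟨j, Nat.lt_succ_of_lt hj⟩, y) = 0)
    (haxT : ∀ yc ∈ Λs (m + 1) (m + 1), ‖((axialT (dbarIterU (m + 1) W₁) y₀ (coverAt P (m + 1) yc) : 𝔸ˣ) : 𝔸) - 1‖ < 1)
    -- the top-step windows at the Sect. E sizes (✓p636261's letters VERBATIM, `B₀' := B₀'H`)
    (ha₁' : α₄ / 4 + B₀'H * (Cb + ‖th‖) ≤ 1 / 24) (hb₁' : α₄ / 4 + B₀'H * (Cb + ‖th‖) ≤ 1 / 140)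
    (hθ : 10 * (α₄ / 4 + B₀'H * (Cb + ‖th‖)) * BR ≤ 1 / 2) (hh₀' : B₀'H * (Cb + ‖th‖) ≤ 3 * α₄ / 4)
    (h103 : BG * Mc P.d BR (α₄ / 4 + B₀'H * (Cb + ‖th‖)) cA (B₂' * (Cb + ‖th‖)) cDA ≤ α₄ / 4)
    (h106 : BG * Kc P.d BR (α₄ / 4 + B₀'H * (Cb + ‖th‖)) cA (B₂' * (Cb + ‖th‖)) cDA (B₂' * (2 * Cl)) (1 + B₀'H * (2 * Cl)) (1 + B₀'H * (2 * Cl))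
      ≤ 1 / 2)
    -- (E) the three top rows in torus letters on the tower box (✓p636261's letters VERBATIM at `k := m + 1`)
    (hTop121 : ∀ yc ∈ Λs (m + 1) (m + 1), ∀ l₀ : Literature.MathematicalPhysics.QuantumFieldTheory.Balaban1983to89.Site P 0 → 𝔸,
      (∀ x : Site P.d, InBox (tlo P.L yc (m + 1)) (thi P.L yc (m + 1)) x → ‖l₀ (cover P x)‖ ≤ α₄) →
      (∀ (x : Site P.d) (κ : Fin P.d), InBox (tlo P.L yc (m + 1)) (thi P.L yc (m + 1)) x → InBox (tlo P.L yc (m + 1)) (thi P.L yc (m + 1)) (x + e κ) →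
        ‖l₀ (cover P (x + e κ)) - l₀ (cover P x)‖ ≤ α₄ * ((P.L : ℝ) ^ (m + 1))⁻¹) →
      exp (mlog ((κf l₀ (m + 1) (coverAt P (m + 1) yc) : 𝔸ˣ) : 𝔸)) = ((κf l₀ (m + 1) (coverAt P (m + 1) yc) : 𝔸ˣ) : 𝔸) ∧
        ‖mlog ((κf l₀ (m + 1) (coverAt P (m + 1) yc) : 𝔸ˣ) : 𝔸) - siteAvgIter (m + 1) l₀ (coverAt P (m + 1) yc)‖ ≤ Cb)
    (hTop125 : ∀ yc ∈ Λs (m + 1) (m + 1), ∀ (l₁ l₂ : Literature.MathematicalPhysics.QuantumFieldTheory.Balaban1983to89.Site P 0 → 𝔸) (r : ℝ), 0 ≤ r →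
      (∀ x : Site P.d, InBox (tlo P.L yc (m + 1)) (thi P.L yc (m + 1)) x → ‖l₁ (cover P x)‖ ≤ α₄) →
      (∀ (x : Site P.d) (κ : Fin P.d), InBox (tlo P.L yc (m + 1)) (thi P.L yc (m + 1)) x → InBox (tlo P.L yc (m + 1)) (thi P.L yc (m + 1)) (x + e κ) →
        ‖l₁ (cover P (x + e κ)) - l₁ (cover P x)‖ ≤ α₄ * ((P.L : ℝ) ^ (m + 1))⁻¹) →
      (∀ x : Site P.d, InBox (tlo P.L yc (m + 1)) (thi P.L yc (m + 1)) x → ‖l₂ (cover P x)‖ ≤ α₄) →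
      (∀ (x : Site P.d) (κ : Fin P.d), InBox (tlo P.L yc (m + 1)) (thi P.L yc (m + 1)) x → InBox (tlo P.L yc (m + 1)) (thi P.L yc (m + 1)) (x + e κ) →
        ‖l₂ (cover P (x + e κ)) - l₂ (cover P x)‖ ≤ α₄ * ((P.L : ℝ) ^ (m + 1))⁻¹) →
      (∀ x : Site P.d, InBox (tlo P.L yc (m + 1)) (thi P.L yc (m + 1)) x → ‖l₁ (cover P x) - l₂ (cover P x)‖ ≤ r) →
      (∀ (x : Site P.d) (κ : Fin P.d), InBox (tlo P.L yc (m + 1)) (thi P.L yc (m + 1)) x → InBox (tlo P.L yc (m + 1)) (thi P.L yc (m + 1)) (x + e κ) →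
        ‖(l₁ (cover P (x + e κ)) - l₂ (cover P (x + e κ))) - (l₁ (cover P x) - l₂ (cover P x))‖ ≤ r * ((P.L : ℝ) ^ (m + 1))⁻¹) →
      ‖(mlog ((κf l₁ (m + 1) (coverAt P (m + 1) yc) : 𝔸ˣ) : 𝔸) - siteAvgIter (m + 1) l₁ (coverAt P (m + 1) yc)) -
          (mlog ((κf l₂ (m + 1) (coverAt P (m + 1) yc) : 𝔸ˣ) : 𝔸) - siteAvgIter (m + 1) l₂ (coverAt P (m + 1) yc))‖ ≤ Cl * r)
    (hTopReal : ∀ yc ∈ Λs (m + 1) (m + 1), ∀ l₀ : Literature.MathematicalPhysics.QuantumFieldTheory.Balaban1983to89.Site P 0 → 𝔸,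
      (∀ x : Site P.d, InBox (tlo P.L yc (m + 1)) (thi P.L yc (m + 1)) x → ‖l₀ (cover P x)‖ ≤ α₄) →
      (∀ (x : Site P.d) (κ : Fin P.d), InBox (tlo P.L yc (m + 1)) (thi P.L yc (m + 1)) x → InBox (tlo P.L yc (m + 1)) (thi P.L yc (m + 1)) (x + e κ) →
        ‖l₀ (cover P (x + e κ)) - l₀ (cover P x)‖ ≤ α₄ * ((P.L : ℝ) ^ (m + 1))⁻¹) →
      mlog ((κf (fun s => -star (l₀ s)) (m + 1) (coverAt P (m + 1) yc) : 𝔸ˣ) : 𝔸) - siteAvgIter (m + 1) (fun s => -star (l₀ s)) (coverAt P (m + 1) yc) =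
        -star (mlog ((κf l₀ (m + 1) (coverAt P (m + 1) yc) : 𝔸ˣ) : 𝔸) - siteAvgIter (m + 1) l₀ (coverAt P (m + 1) yc))) :
    ∃ lam : Site P.d → 𝔸, (∀ x, IsSelfAdjoint (lam x)) ∧ (∀ x, x ∉ Ω 0 → lam x = 0) ∧
      (∀ j, j ≤ m + 1 → ∀ b ∈ {b : Site P.d × Fin P.d | SideTouches (Ω j) b.1 b.2},
        ‖lam b.1‖ ≤ α₄ ∧ wt P.L η j * ‖covDerivFwd η (1 : Site P.d → Fin P.d → 𝔸ˣ) b.2 lam b.1‖ ≤ α₄) ∧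
      (∃ μ : ℕ → Site P.d → 𝔸, ∀ x ∈ Ω 0,
        covLap η (1 : Site P.d → Fin P.d → 𝔸ˣ) ((Ω 0).indicator fun y =>
          covDivB η (1 : Site P.d → Fin P.d → 𝔸ˣ) A y + covLap η (1 : Site P.d → Fin P.d → 𝔸ˣ) lam y +
          ((conjR (gaugeExp lam y)⁻¹ (covDivB η (1 : Site P.d → Fin P.d → 𝔸ˣ) A y) - covDivB η (1 : Site P.d → Fin P.d → 𝔸ˣ) A y) +
            (gAd (covLap η (1 : Site P.d → Fin P.d → 𝔸ˣ) lam y) (lam y) - covLap η (1 : Site P.d → Fin P.d → 𝔸ˣ) lam y) +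
            ∑ μ, frakF3 η (1 : Site P.d → Fin P.d → 𝔸ˣ) lam A y μ)) x = QT P.L (m + 1) (Λs (m + 1)) (1 : Site P.d → Fin P.d → 𝔸ˣ) μ x) ∧
      (∀ j, j < m + 1 → ∀ y ∈ Λs (m + 1) j,
        Qnl P.L (1 : Site P.d → Fin P.d → 𝔸ˣ) (fun x => expUnit (((-I) • lam) x)) u₁⁻¹ j y = 0) ∧
      (∀ yc ∈ Λs (m + 1) (m + 1), κf (((-I) • lam) ∘ rep) (m + 1) (coverAt P (m + 1) yc) = axialT (dbarIterU (m + 1) W₁) y₀ (coverAt P (m + 1) yc)) ∧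
      (∀ x ∈ Ω 0, ∀ μ : Fin P.d,
        wt P.L η 0 * ‖A x μ‖ ≤ cA ∧ wt P.L η 0 * ‖conjR ((1 : Site P.d → Fin P.d → 𝔸ˣ) (x - e μ) μ)⁻¹ (A (x - e μ) μ)‖ ≤ cA) := by
  subst hcs
  have hU₀ : ∀ (x : Site P.d) (κ : Fin P.d), (1 : Site P.d → Fin P.d → 𝔸ˣ) x κ ∈ unitaryUnits 𝔸 := fun _ _ => (unitaryUnits 𝔸).one_mem
  have hL1 : 1 ≤ P.L := le_trans (by norm_num) hL
  have hd1 : 1 ≤ P.d := le_trans (by norm_num) hd2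
  have hLr : (1 : ℝ) ≤ P.L := by exact_mod_cast hL1
  have hmK : m + 1 ≤ K₀ := hmk
  have hsum : 0 < α₀ + α₁ := add_pos hα₀ hα₁
  have hcs0 : 0 ≤ 5 * (P.d : ℝ) * P.L * B₀ * (α₀ + α₁) := by positivity
  have hcspos : 0 < 5 * (P.d : ℝ) * P.L * B₀ * (α₀ + α₁) := by positivity
  have hα₄pos : 0 < α₄ := by rw [hα₄]; positivity
  -- `c⋆ ≤ L·c⋆ ≤ cB`, hence Prop. 3's remaining windows from the JOIN's (N05's arithmetic verbatim)
  have hcsB : 5 * (P.d : ℝ) * P.L * B₀ * (α₀ + α₁) ≤ cB := (le_mul_of_one_le_left hcs0 hLr).trans hcBlo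
  have hcB0 : 0 ≤ cB := hcs0.trans hcsB
  have hcA0 : 0 ≤ cA := (hcs0.trans (le_mul_of_one_le_left hcs0 hLr)).trans hcAlo
  have hcDA0 : 0 ≤ cDA := le_trans (by positivity) hcDAlo
  have hd0 : (1 : ℝ) ≤ P.d := by exact_mod_cast hd1
  have hcBsmall : (P.d : ℝ) * cB ≤ 1 / 8000 := by linarith only [hα₃']
  have hdcs : (P.d : ℝ) * (5 * (P.d : ℝ) * P.L * B₀ * (α₀ + α₁)) ≤ 1 / 8000 :=
    (mul_le_mul_of_nonneg_left hcsB (by positivity)).trans hcBsmall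
  have hcs8000 : 5 * (P.d : ℝ) * P.L * B₀ * (α₀ + α₁) ≤ 1 / 8000 := (le_mul_of_one_le_left hcs0 hd0).trans hdcs
  have h16 : 16 * (5 * (P.d : ℝ) * P.L * B₀ * (α₀ + α₁)) ≤ 1 := by linarith only [hcs8000]
  have h50 : 50 * P.d * (5 * (P.d : ℝ) * P.L * B₀ * (α₀ + α₁)) ≤ 1 := by linarith only [hdcs]
  have hd5 : 5 * (5 * (P.d : ℝ) * P.L * B₀ * (α₀ + α₁)) * ((P.d : ℝ) - 1) ≤ 4 := by nlinarith only [hdcs, hcs0]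
  have hc₃3 : 2 * (5 * (P.d : ℝ) * P.L * B₀ * (α₀ + α₁)) ≤ c3 P.d P.L := by linarith only [hc₃, hcsB]
  have hsmall3 : Real.exp (4 * (800 * ((P.d : ℝ) + 1) ^ 2 * ((P.d : ℝ) + 4)) * α₀) *
      (1 + 8 * (131072 * ((P.d : ℝ) + 1) ^ 2) * (5 * (P.d : ℝ) * P.L * B₀ * (α₀ + α₁))) ≤ 2 := by
    refine le_trans (mul_le_mul_of_nonneg_left ?_ (Real.exp_pos _).le) hsmall
    have h := mul_le_mul_of_nonneg_left hcsB (show (0 : ℝ) ≤ 8 * (131072 * ((P.d : ℝ) + 1) ^ 2) by positivity)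
    linarith only [h]
  have hαP2 : 2 * α₀ ≤ c2' P.d P.L := by linarith only [hα4, hα₀]
  -- the MASKED exponent `A′` of the datum (globally Hermitian, `= A` on the touched bonds)
  obtain ⟨A', hsa, hagree, hWA, hA0⟩ := exists_masked_datum hdat
  have hWA1 : ∀ j, j ≤ m → ∀ (y : Site P.d) (τ : Fin P.d), SideTouches (Ω j) y τ → U₁ y τ = cfgExp η A' y τ :=
    fun j hj y τ hs => (hWA j hj y τ hs).1
  have h41 : ∀ j, j ≤ m → ∀ (y : Site P.d) (τ : Fin P.d), SideTouches (Ω j) y τ →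
      ‖A' y τ‖ ≤ (5 * (P.d : ℝ) * P.L * B₀ * (α₀ + α₁)) * ((P.L : ℝ) ^ j * η)⁻¹ := fun j hj y τ hs => (hWA j hj y τ hs).2
  -- the datum binders BY NAME (`B8Prop5SocketDatum` §7, §1, §5), exactly as N05 reads them
  have h33' := h33_of_inAk hL1 hα₀ h33 hmK htower
  have hP' := hP_of_datum hL1 hα₀ hΩ h34 hmK htower hu₁ hW hWA1
  have h69' : ∀ j, j ≤ m + 1 → ∀ y ∈ Λs (m + 1) j, ∀ (x : Site P.d) (κ : Fin P.d), InBox (tlo P.L y j) (thi P.L y j) x →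
      InBox (tlo P.L y j) (thi P.L y j) (x + e κ) → ‖iEta η A' x κ‖ ≤ cB * ((P.L : ℝ) ^ j)⁻¹ :=
    fun j hj y hy x κ hx hxe =>
      (h69_of_datum hd2 hL1 hη hΩ htower hcs0 h41 j hj y hy x κ hx hxe).trans (mul_le_mul_of_nonneg_right hcBlo (by positivity))
  have hA' : ∀ j, j ≤ m + 1 → ∀ x ∈ Ω j, ∀ μ : Fin P.d,
      wt P.L η j * ‖A' x μ‖ ≤ cA ∧ wt P.L η j * ‖conjR ((1 : Site P.d → Fin P.d → 𝔸ˣ) (x - e μ) μ)⁻¹ (A' (x - e μ) μ)‖ ≤ cA := fun j hj x hx μ =>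
    ⟨(hA_of_datum hd2 hL1 hη hΩ hU₀ hcs0 h41 j hj x hx μ).1.trans hcAlo, (hA_of_datum hd2 hL1 hη hΩ hU₀ hcs0 h41 j hj x hx μ).2.trans hcAlo⟩
  have hBu : ∀ (x : Site P.d) (κ : Fin P.d), B8Eq146AExpansion.expCfg (iEta η A') x κ ∈ unitaryUnits 𝔸 := expCfg_iEta_mem_unitaryUnits η hsa
  have hAx' : InAx P.L (m + 1) (Λs (m + 1)) (1 : Site P.d → Fin P.d → 𝔸ˣ)
      (mgauge (1 : Site P.d → Fin P.d → 𝔸ˣ) u₁ (B8Eq146AExpansion.expCfg (iEta η A')) * (1 : Site P.d → Fin P.d → 𝔸ˣ)) :=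
    inAx_mgauge_expCfg_of_datum hd2 hL1 hΩ htower hW hWA1 (hAx (m + 1) hmK)
  have h129' : Restr129 P.L (m + 1) (Λs (m + 1)) (1 : Site P.d → Fin P.d → 𝔸ˣ) u₁ := restr129_succ_of_truncation hL1 hlt htop h129
  -- the source `D*A′`: (1.69)'s gradient member by Prop. 3 at level `m`, then `|D*A′|₍₋₂₎ ≤ d·L²·c⋆ ≤ cDA`; Hermitian
  have hgrad := grad_bound_of_datum hd2 hη hL K₀ hU₀ hU' hα₀ hα₁ hcspos hB₀.le hα3 hα4 h16 hd5 hsmall3 hc₃3 hside h50 hC₂ h61 hsmall₁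
    Ω hΩ Λs Λb hbox hclass h33 h34 hAx h135 hm1 hmk.le SB9 hα₀9 hcs9 hu₁ hW h129 hLan hsa hWA hA0
  have hDA : Bd2 P.L η (m + 1) Ω (fun y => covDivB η (1 : Site P.d → Fin P.d → 𝔸ˣ) A' y) cDA := fun j hj x hx =>
    (bd2_covDivB_of_grad hd2 hL1 hη hΩ hU₀ hcs0 hgrad j hj x hx).trans hcDAlo
  have hDAsa : ∀ j, j ≤ m + 1 → ∀ x ∈ Ω j, IsSelfAdjoint (covDivB η (1 : Site P.d → Fin P.d → 𝔸ˣ) A' x) :=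
    fun j _ x _ => isSelfAdjoint_covDivB hU₀ hsa x
  -- the JOIN's bond classes `Eb j := {b ∣ SideTouches (Ω j) b}` (§6)
  have hEbΩ : ∀ j, j ≤ m + 1 → ∀ x ∈ Ω j, ∀ μ : Fin P.d, (x, μ) ∈ {b : Site P.d × Fin P.d | SideTouches (Ω j) b.1 b.2} ∧
      (x - e μ, μ) ∈ {b : Site P.d × Fin P.d | SideTouches (Ω j) b.1 b.2} := fun j _ x hx μ => sideTouches_pair_of_mem hd2 hx μ
  have hEbT : ∀ j, j ≤ m + 1 → ∀ y ∈ Λs (m + 1) j, ∀ (x : Site P.d) (κ : Fin P.d), InBox (tlo P.L y j) (thi P.L y j) x →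
      InBox (tlo P.L y j) (thi P.L y j) (x + e κ) → (x, κ) ∈ {b : Site P.d × Fin P.d | SideTouches (Ω j) b.1 b.2} :=
    fun j hj y hy x κ hx _ => sideTouches_of_tower_bond hd2 htower hj hy x κ hx
  -- the LOWER FAMILY rows (C) at `(Λs (m+1), U₀ := 1)` from the datum (FILE A), weakened to the top step's `Cb`, `Cl`
  obtain ⟨hC121, hC125, hCreal⟩ := lowerFamily_rows hd1 hL hU₀ (Λs (m + 1)) hα₀ hα3 hα4 hcB0 hα₄pos hα₀ hα3 hαP2 hBu h33' h69' hP' hAx'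
    h129' hsmall hc₃ hsc hα₃' hs₁ hs₂ hs₃ hs₄ hs₅ hs₆ hs₇ hprod8
  have hC2 : 0 ≤ C2p P.d := C2p_nonneg P.d
  have hCb : 0 ≤ Cb := le_trans (by positivity) hCblo
  have hCl : 0 ≤ Cl := le_trans (by positivity) hCllo
  -- THE TOP STEP (✓p636261, BY NAME) at `k := m + 1`, `Λs := Λs (m+1)`, `A := A′`
  obtain ⟨lam, hlsa, hloff, h108, ⟨μ, hmul⟩, hlo, htopId⟩ := hFP_kLevel_top_RD (P := P) (k := m + 1) (Λs := Λs (m + 1))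
    (Eb := fun j => {b : Site P.d × Fin P.d | SideTouches (Ω j) b.1 b.2}) (A := A') hmP hη hEbΩ hEbT g Δ q qs Aw c g_rightΩ c_range hΔ hqs H'
    hα₄pos hB₀'H hB₂' hCb hCl hH0 hH1 hH2 hHsupp hHequiv hCbρ hClB hBG hBR hcA0 hcA' hcDA0 hG hGsupp hGreal hRbd hRreal hDA hDAsa hA' hsa hQH hq u₁
    (fun j hj y hy μ' hb ha => (hC121 j hj.le y hy μ' hb ha).trans hCblo)
    (fun j hj y hy μ₁ μ₂ r hr h1b h1a h2b h2a hmb hma =>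
      (hC125 j hj.le y hy μ₁ μ₂ r hr h1b h1a h2b h2a hmb hma).trans (mul_le_mul_of_nonneg_right hCllo hr))
    (fun j hj y hy μ' hb ha => hCreal j hj.le y hy μ' hb ha)
    W₁ κf rep hrep y₀ th hτ hth hthk hthlo haxT ha₁' hb₁' hθ hh₀' h103 h106 hTop121 hTop125 hTopReal
  refine ⟨lam, hlsa, hloff, fun j hj b hb => h108 j hj b hb, ⟨μ, fun x hx => ?_⟩, hlo, htopId, fun x hx μ' => ?_⟩
  · -- transport the multiplier clause from `A′` back to `A`: the two agree on the bonds read on `Ω₀`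
    have hind : ((Ω 0).indicator fun y => covDivB η (1 : Site P.d → Fin P.d → 𝔸ˣ) A y + covLap η (1 : Site P.d → Fin P.d → 𝔸ˣ) lam y +
          ((conjR (gaugeExp lam y)⁻¹ (covDivB η (1 : Site P.d → Fin P.d → 𝔸ˣ) A y) - covDivB η (1 : Site P.d → Fin P.d → 𝔸ˣ) A y) +
            (gAd (covLap η (1 : Site P.d → Fin P.d → 𝔸ˣ) lam y) (lam y) - covLap η (1 : Site P.d → Fin P.d → 𝔸ˣ) lam y) +
            ∑ μ, frakF3 η (1 : Site P.d → Fin P.d → 𝔸ˣ) lam A y μ)) =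
        ((Ω 0).indicator fun y => covDivB η (1 : Site P.d → Fin P.d → 𝔸ˣ) A' y + covLap η (1 : Site P.d → Fin P.d → 𝔸ˣ) lam y +
          ((conjR (gaugeExp lam y)⁻¹ (covDivB η (1 : Site P.d → Fin P.d → 𝔸ˣ) A' y) - covDivB η (1 : Site P.d → Fin P.d → 𝔸ˣ) A' y) +
            (gAd (covLap η (1 : Site P.d → Fin P.d → 𝔸ˣ) lam y) (lam y) - covLap η (1 : Site P.d → Fin P.d → 𝔸ˣ) lam y) +
            ∑ μ, frakF3 η (1 : Site P.d → Fin P.d → 𝔸ˣ) lam A' y μ)) := by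
      refine Set.indicator_congr fun y hy => ?_
      have h₁ : ∀ ν : Fin P.d, A' y ν = A y ν := fun ν => hagree 0 (Nat.zero_le _) y ν (sideTouches_pair_of_mem hd2 hy ν).1
      have h₂ : ∀ ν : Fin P.d, A' (y - e ν) ν = A (y - e ν) ν := fun ν => hagree 0 (Nat.zero_le _) (y - e ν) ν (sideTouches_pair_of_mem hd2 hy ν).2
      have h₃ : ∀ ν : Fin P.d, frakF3 η (1 : Site P.d → Fin P.d → 𝔸ˣ) lam A' y ν = frakF3 η (1 : Site P.d → Fin P.d → 𝔸ˣ) lam A y ν :=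
        fun ν => frakF3_congr_at η _ lam (h₁ ν) (h₂ ν)
      simp only [covDivB_congr_at η _ h₁ h₂, h₃]
    rw [hind]
    exact hmul x hx
  · -- the level-`0` size row of `A` on `Ω₀` (for ✓`isLandau138W_of_topStepOutput`): `A = A′` on the stars of `Ω₀`
    have h := hA' 0 (Nat.zero_le _) x hx μ'
    rw [hagree 0 (Nat.zero_le _) x μ' (sideTouches_pair_of_mem hd2 hx μ').1,
      hagree 0 (Nat.zero_le _) (x - e μ') μ' (sideTouches_pair_of_mem hd2 hx μ').2] at h
    exact h

end Summit.QuantumFields.YangMills.Theorems.HalvingP1FlatCoreSupplierTopCall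

end
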